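import Summits.CriticalPhenomena.PercolationContinuityZ3.Theorems.PercNearOneGluingNoHeavyLowerTailKnQuestion8CoefficientwiseCoreClassKernelMixCycleWords
import Summits.CriticalPhenomena.PercolationContinuityZ3.Theorems.PercNearOneGluingNoHeavyLowerTailKnQuestion8CoefficientwiseCoreClassKernelMixHSpace

/-!
# The cycle-word lattice is a cycle factor (single-cycle input of the two-type theorem)

Support file (`--supports stmt-CriticalPhenomena-4575`, closed), prover `prim-cplus-coupling` (gen 66).  No notations, no named facts, no sorries;
standard axioms.  Memo `prim-cplus-coupling/A5-COUPLING-gen66.md` §1.1, §3.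

On the cycle words `Bool × Finset α × Bool` (memo §3; `CycleWords`) we fix, for every level `V`, a matching `cycPhi V`:
the explicit SHORT CHAIN SHIFT `⊥ ↦ y⁰ ↦ ⊤`, identity elsewhere, when `V` is the full level; a bi-disciplined increasing injection
(`CycleWords.exists_bidisciplined_injection`, chosen) when `V` is a nonempty proper level; and the layer map `cycLam : ⊤ ↦ y⁰ ↦ ⊥`, identity
elsewhere.  THEOREM `isCycleFactor_cycleWords`: these data form an `HSpace.IsCycleFactor` with witness region `NF = {w ≠ ⊤}` and rows
`NE = {w ≠ ⊥}` — in particular every source lies below the layer of its target.  With `HSpace.isHSpace_prod` and `HSpace.isHSpace_unit` this yields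
the invariant H on every bouquet of cycles (iterated product), hence JP-match / JP / (X2) (memo §2 corollaries; assembled in a later file).
[cite: KozmaNitzan2024, Questions 8–9 (§5.5 p. 36) (context); Harris 1960; Kleitman 1966]
-/

namespace Summit.CriticalPhenomena.PercolationContinuityZ3.Theorems.Coefficientwise.CycleFactor

open Finset CycleWords HSpace

variable {α : Type*} [Fintype α] [DecidableEq α]

/-- The full word `⊤ = (R, everything, R)`. -/
def topW (α : Type*) [Fintype α] : Bool × Finset α × Bool := (true, (univ, true))
/-- The empty word `⊥ = (B, ∅, B)`. -/
def botW (α : Type*) : Bool × Finset α × Bool := (false, (∅, false))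
/-- The word `y⁰ = (B, everything, B)`: all interior edges red, both hub edges blue. -/
def y0W (α : Type*) [Fintype α] : Bool × Finset α × Bool := (false, (univ, false))

/-- Mirror of the full word. -/
@[simp] theorem cw_topW : cw (topW α) = botW α := by simp [topW, botW, cw]
/-- Mirror of the empty word. -/
@[simp] theorem cw_botW : cw (botW α) = topW α := by simp [topW, botW, cw]
omit [DecidableEq α] in
/-- `⊤` is the greatest word. -/
theorem le_topW (w : Bool × Finset α × Bool) : w ≤ topW α := by
  obtain ⟨a, μ, b⟩ := w; exact ⟨le_top, subset_univ μ, le_top⟩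
omit [Fintype α] [DecidableEq α] in
/-- `⊥` is the least word. -/
theorem botW_le (w : Bool × Finset α × Bool) : botW α ≤ w := by
  obtain ⟨a, μ, b⟩ := w; exact ⟨bot_le, empty_subset μ, bot_le⟩
omit [DecidableEq α] in
/-- `y⁰ ≤ ⊤`. -/
theorem y0W_le_topW : y0W α ≤ topW α := ⟨bot_le, subset_rfl, bot_le⟩
omit [DecidableEq α] in
/-- `⊥ ≠ ⊤`. -/
theorem botW_ne_topW : botW α ≠ topW α := by simp [botW, topW]
omit [DecidableEq α] in
/-- `y⁰ ≠ ⊤`. -/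
theorem y0W_ne_topW : y0W α ≠ topW α := by simp [y0W, topW]
omit [DecidableEq α] in
/-- `y⁰ ≠ ⊥` (there is an interior edge). -/
theorem y0W_ne_botW [Nonempty α] : y0W α ≠ botW α := by
  simp [y0W, botW, Finset.univ_eq_empty_iff, not_isEmpty_of_nonempty]

omit [DecidableEq α] in
/-- `cw y⁰ ≠ ⊤` fails only without interior edges: here `(true, ∅, true) ≠ ⊤`. -/
theorem RR_empty_ne_topW [Nonempty α] : ((true, ((∅ : Finset α), true)) : Bool × Finset α × Bool) ≠ topW α := by
  intro h
  have h' : (∅ : Finset α) = univ := by simpa [topW] using h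
  exact Finset.univ_nonempty.ne_empty h'.symm

/-- The short chain shift of the full level: `⊥ ↦ y⁰`, `y⁰ ↦ ⊤`, identity elsewhere. -/
def chainPhi (w : Bool × Finset α × Bool) : Bool × Finset α × Bool :=
  if w = botW α then y0W α else if w = y0W α then topW α else w

/-- The layer map: `⊤ ↦ y⁰`, `y⁰ ↦ ⊥`, identity elsewhere. -/
def cycLam (w : Bool × Finset α × Bool) : Bool × Finset α × Bool :=
  if w = topW α then y0W α else if w = y0W α then botW α else w

/-- `chainPhi ⊥ = y⁰`. -/
theorem chainPhi_bot : chainPhi (botW α) = y0W α := by simp [chainPhi]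
/-- `chainPhi y⁰ = ⊤`. -/
theorem chainPhi_y0 [Nonempty α] : chainPhi (y0W α) = topW α := by simp [chainPhi, y0W_ne_botW]
/-- `chainPhi` is the identity off the chain. -/
theorem chainPhi_other {w : Bool × Finset α × Bool} (h1 : w ≠ botW α) (h2 : w ≠ y0W α) : chainPhi w = w := by
  simp [chainPhi, h1, h2]
/-- `cycLam ⊤ = y⁰`. -/
theorem cycLam_top : cycLam (topW α) = y0W α := by simp [cycLam]
/-- `cycLam y⁰ = ⊥`. -/
theorem cycLam_y0 : cycLam (y0W α) = botW α := by simp [cycLam, y0W_ne_topW]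
/-- `cycLam` is the identity off the chain. -/
theorem cycLam_other {w : Bool × Finset α × Bool} (h1 : w ≠ topW α) (h2 : w ≠ y0W α) : cycLam w = w := by
  simp [cycLam, h1, h2]
/-- `chainPhi` is a left inverse of `cycLam` on the rows `{w ≠ ⊥}`. -/
theorem chainPhi_cycLam [Nonempty α] {w : Bool × Finset α × Bool} (hw : w ≠ botW α) : chainPhi (cycLam w) = w := by
  by_cases h1 : w = topW α
  · rw [h1, cycLam_top, chainPhi_y0]
  · by_cases h2 : w = y0W α
    · rw [h2, cycLam_y0, chainPhi_bot]
    · rw [cycLam_other h1 h2, chainPhi_other hw h2]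

/-- A level is FULL if it contains every non-full word. -/
def IsFull (V : Finset (Bool × Finset α × Bool)) : Prop := ∀ w, w ≠ topW α → w ∈ V

open Classical in
/-- The matching of a level: the chain shift on the full level, a chosen bi-disciplined increasing injection on a nonempty proper level,
the identity otherwise. -/
noncomputable def cycPhi (V : Finset (Bool × Finset α × Bool)) : (Bool × Finset α × Bool) → (Bool × Finset α × Bool) :=
  if IsFull V then chainPhi
  else if h : IsLevel V ∧ V.Nonempty ∧ ∃ w : Bool × Finset α × Bool, w ≠ (true, (univ, true)) ∧ w ∉ V then
    Classical.choose (exists_bidisciplined_injection V h.1 h.2.1 h.2.2)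
  else id

open Classical in
/-- Specification of `cycPhi` on a nonempty proper level. -/
theorem cycPhi_spec_proper (V : Finset (Bool × Finset α × Bool)) (hV : IsLevel V) (hne : V.Nonempty) (hnf : ¬ IsFull V) :
    Set.InjOn (cycPhi V) (V : Set (Bool × Finset α × Bool)) ∧
      ∀ y ∈ V, y ≤ cycPhi V y ∧ cw (cycPhi V y) ∈ V ∧ (cycPhi V y = topW α → y ≤ y0W α) := by
  have hex : ∃ w : Bool × Finset α × Bool, w ≠ (true, (univ, true)) ∧ w ∉ V := by
    by_contra h
    refine hnf (fun w hw => ?_)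
    by_contra hw2
    exact h ⟨w, hw, hw2⟩
  have hh : IsLevel V ∧ V.Nonempty ∧ ∃ w : Bool × Finset α × Bool, w ≠ (true, (univ, true)) ∧ w ∉ V := ⟨hV, hne, hex⟩
  have hdef : cycPhi V = Classical.choose (exists_bidisciplined_injection V hh.1 hh.2.1 hh.2.2) := by
    unfold cycPhi; rw [if_neg hnf, dif_pos hh]
  rw [hdef]
  exact Classical.choose_spec (exists_bidisciplined_injection V hh.1 hh.2.1 hh.2.2)

/-- **The cycle-word lattice is a cycle factor.**  Memo gen 66 §1.1/§3: levels `IsLevel`, matchings `cycPhi`, layer map `cycLam`,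
witness region `NF = {w ≠ ⊤}`, rows `NE = {w ≠ ⊥}`. -/
theorem isCycleFactor_cycleWords [Nonempty α] :
    IsCycleFactor (Y := Bool × Finset α × Bool) (univ.erase (topW α)) (univ.erase (botW α)) cw IsLevel cycPhi cycLam := by
  classical
  have htop : ∀ V : Finset (Bool × Finset α × Bool), IsLevel V → topW α ∉ V := fun V hV => hV.2.1
  have hcyc_full : ∀ V : Finset (Bool × Finset α × Bool), IsFull V → cycPhi V = chainPhi := by
    intro V hF; unfold cycPhi; rw [if_pos hF]
  refine ⟨?_, ?_, ?_, ?_, ?_, ?_, ?_, ?_⟩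
  · -- level_sub
    intro V hV w hw
    exact mem_erase.mpr ⟨fun h => htop V hV (h ▸ hw), mem_univ _⟩
  · -- incr
    intro V hV y hy
    by_cases hF : IsFull V
    · rw [hcyc_full V hF]
      by_cases h1 : y = botW α
      · rw [h1, chainPhi_bot]; exact botW_le _
      · by_cases h2 : y = y0W α
        · rw [h2, chainPhi_y0]; exact le_topW _
        · rw [chainPhi_other h1 h2]
    · exact ((cycPhi_spec_proper V hV ⟨y, hy⟩ hF).2 y hy).1
  · -- mirror
    intro V hV y hy
    by_cases hF : IsFull V
    · rw [hcyc_full V hF]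
      by_cases h1 : y = botW α
      · rw [h1, chainPhi_bot]
        refine hF _ ?_
        simpa [y0W, cw] using (RR_empty_ne_topW (α := α))
      · by_cases h2 : y = y0W α
        · rw [h2, chainPhi_y0, cw_topW]; exact hF _ botW_ne_topW
        · rw [chainPhi_other h1 h2]
          refine hF _ (fun hc => h1 ?_)
          have := congrArg cw hc
          rwa [cw_cw, cw_topW] at this
    · exact ((cycPhi_spec_proper V hV ⟨y, hy⟩ hF).2 y hy).2.1
  · -- inj
    intro V hV y hy y' hy' e
    by_cases hF : IsFull V
    · rw [hcyc_full V hF] at e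
      -- apply the left inverse cycLam of chainPhi on non-full words
      have key : ∀ w : Bool × Finset α × Bool, w ≠ topW α → cycLam (chainPhi w) = w := by
        intro w hw
        by_cases h1 : w = botW α
        · rw [h1, chainPhi_bot, cycLam_y0]
        · by_cases h2 : w = y0W α
          · rw [h2, chainPhi_y0, cycLam_top]
          · rw [chainPhi_other h1 h2, cycLam_other hw h2]
      have := congrArg cycLam e
      rwa [key y (fun h => htop V hV (h ▸ hy)), key y' (fun h => htop V hV (h ▸ hy'))] at this
    · exact (cycPhi_spec_proper V hV ⟨y, hy⟩ hF).1 (mem_coe.mpr hy) (mem_coe.mpr hy') e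
  · -- target_mem: φ V y ≠ ⊥ since cw (φ V y) ∈ V ∌ ⊤
    intro V hV y hy
    have hm : cw (cycPhi V y) ∈ V := by
      by_cases hF : IsFull V
      · rw [hcyc_full V hF]
        by_cases h1 : y = botW α
        · rw [h1, chainPhi_bot]; refine hF _ ?_; simpa [y0W, cw] using (RR_empty_ne_topW (α := α))
        · by_cases h2 : y = y0W α
          · rw [h2, chainPhi_y0, cw_topW]; exact hF _ botW_ne_topW
          · rw [chainPhi_other h1 h2]
            refine hF _ (fun hc => h1 ?_)
            have := congrArg cw hc
            rwa [cw_cw, cw_topW] at this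
      · exact ((cycPhi_spec_proper V hV ⟨y, hy⟩ hF).2 y hy).2.1
    refine mem_erase.mpr ⟨fun h => ?_, mem_univ _⟩
    rw [h, cw_botW] at hm
    exact htop V hV hm
  · -- lam_inj on NE (left inverse chainPhi)
    intro a ha b hb e
    have ha' : a ≠ botW α := (mem_erase.mp (mem_coe.mp ha)).1
    have hb' : b ≠ botW α := (mem_erase.mp (mem_coe.mp hb)).1
    have := congrArg chainPhi e
    rwa [chainPhi_cycLam ha', chainPhi_cycLam hb'] at this
  · -- lam_mem: λ maps NE into NF
    intro y hy
    refine mem_erase.mpr ⟨?_, mem_univ _⟩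
    by_cases h1 : y = topW α
    · rw [h1, cycLam_top]; exact y0W_ne_topW
    · by_cases h2 : y = y0W α
      · rw [h2, cycLam_y0]; exact botW_ne_topW
      · rw [cycLam_other h1 h2]; exact h1
  · -- src_le_lam
    intro V hV y hy
    by_cases hF : IsFull V
    · rw [hcyc_full V hF]
      by_cases h1 : y = botW α
      · rw [h1, chainPhi_bot, cycLam_y0]
      · by_cases h2 : y = y0W α
        · rw [h2, chainPhi_y0, cycLam_top]
        · rw [chainPhi_other h1 h2, cycLam_other (fun h => htop V hV (h ▸ hy)) h2]
    · obtain ⟨hle, hmir, hdisc⟩ := (cycPhi_spec_proper V hV ⟨y, hy⟩ hF).2 y hy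
      by_cases ht : cycPhi V y = topW α
      · rw [ht, cycLam_top]; exact hdisc ht
      · by_cases h0 : cycPhi V y = y0W α
        · -- a proper level never has y⁰ as a target: cw y⁰ has both hub letters red
          exfalso
          rw [h0] at hmir
          have hRR : ∃ μ : Finset α, (true, (μ, true)) ∈ V := ⟨∅, by simpa [y0W, cw] using hmir⟩
          exact hF (fun w hw => hV.2.2.2 hRR w (by simpa [topW] using hw))
        · rw [cycLam_other ht h0]; exact hle

end Summit.CriticalPhenomena.PercolationContinuityZ3.Theorems.Coefficientwise.CycleFactor
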